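import Literature.Barriers.CriticalPhenomena.RigorousRGSmallParameterPerturbativeCoefficients
import HarnessLib

/-!
# `RigorousRGSmallParameter` (Slade, Theorem 1.4.1): Riemann sums over `Λ⁻¹ℤ^d` for Lipschitz,
# compactly supported functions on `ℝ^d`

Eighth file of the §10.3–§10.4 layer; the "Riemann sum approximation" step of the proof of
Lemma 5.2.2. G. Slade, *Critical exponents for long-range `O(n)` models below the upper critical
dimension*, Commun. Math. Phys. **358** (2018), §10.4: "Riemann sum approximation gives
`(c_k,c_{k+l}) - L^{εk}⟨c₀,c_l⟩ = L^{εk}(L^{-dk}Σ_{y∈L^{-k}ℤ^d}c₀(y)c_l(y) - ∫_{ℝ^d}c₀(y)c_l(y)dy)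
= L^{εk}O(L^{-k})‖∇(c₀c_l)‖_{L^∞} = O(L^{εk}L^{-k}L^{-(d-α)l})`."

Here in the form needed for a Lipschitz (rather than `C¹`) function: if `|F(y) - F(y')| ≤ K‖y-y'‖_∞`
and `F` vanishes off the sup-norm ball of radius `ρ`, then for `Λ ≥ 1`,
`|Λ^{-d}Σ_{x∈ℤ^d}F(x/Λ) - ∫_{ℝ^d}F| ≤ K(2ρ+3)^dΛ⁻¹`. Proof: partition `ℝ^d` into the cells
`Q_x = Π_i[x_i/Λ,(x_i+1)/Λ)` of volume `Λ^{-d}`; on `Q_x`, `|F - F(x/Λ)| ≤ KΛ⁻¹`; only the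
`≤ ((2ρ+3)Λ)^d` cells of the box `|x_i| ≤ Λρ+1` contribute.

## What this file proves (everything; one definition `FRD.cell`, no named fact)

* `FRD.cell` and its API: `measurableSet_cell`, `mem_cell_iff`, `mem_cell_floor`,
  `eq_floor_of_mem_cell`, `pairwise_disjoint_cell`, `iUnion_cell`, `volume_cell`, `volume_real_cell`,
  `norm_sub_corner_le`.
* `FRD.card_box_le` (`#box(R) ≤ (2R+1)^d`), `FRD.exists_abs_gt_of_not_mem_box`.
* **`FRD.abs_riemannSum_sub_integral_le`** — the Riemann-sum estimate (and the integrability of `F`).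
-/

noncomputable section

namespace Literature.Barriers.CriticalPhenomena

open _root_.MeasureTheory Set Filter
open scoped _root_.Topology Real

namespace LongRangePhi4

namespace FRD

open Literature.Probability.LatticeModels

variable {d : ℕ}

/-! ### The cells of the lattice `ℤ^d/Λ` -/

/-- The half-open cell `Q_x = Π_i [x_i/Λ, (x_i+1)/Λ)` of the lattice `Λ⁻¹ℤ^d`. [folklore] -/
def cell (Λ : ℝ) (x : Site d) : Set (Fin d → ℝ) :=
  Set.pi Set.univ fun i => Ico ((x i : ℝ) / Λ) (((x i : ℝ) + 1) / Λ)

/-- Cells are measurable. [folklore] -/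
theorem measurableSet_cell (Λ : ℝ) (x : Site d) : MeasurableSet (cell Λ x) :=
  MeasurableSet.univ_pi fun _ => measurableSet_Ico

/-- Membership in a cell, coordinatewise. [folklore] -/
theorem mem_cell_iff {Λ : ℝ} {x : Site d} {y : Fin d → ℝ} :
    y ∈ cell Λ x ↔ ∀ i, (x i : ℝ) / Λ ≤ y i ∧ y i < ((x i : ℝ) + 1) / Λ := by
  simp [cell, Set.mem_pi, Set.mem_Ico]

/-- For `Λ > 0`, `y` lies in the cell of `x = ⌊Λy⌋` (coordinatewise). [folklore] -/
theorem mem_cell_floor {Λ : ℝ} (hΛ : 0 < Λ) (y : Fin d → ℝ) : y ∈ cell Λ (fun i => ⌊Λ * y i⌋) := by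
  rw [mem_cell_iff]
  intro i
  have h1 := Int.floor_le (Λ * y i)
  have h2 := Int.lt_floor_add_one (Λ * y i)
  constructor
  · rw [div_le_iff₀ hΛ]; linarith
  · rw [lt_div_iff₀ hΛ]; linarith

/-- For `Λ > 0`, `y ∈ Q_x` forces `x = ⌊Λy⌋`. [folklore] -/
theorem eq_floor_of_mem_cell {Λ : ℝ} (hΛ : 0 < Λ) {x : Site d} {y : Fin d → ℝ} (hy : y ∈ cell Λ x) :
    x = fun i => ⌊Λ * y i⌋ := by
  rw [mem_cell_iff] at hy
  funext i
  obtain ⟨h1, h2⟩ := hy i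
  rw [div_le_iff₀ hΛ] at h1
  rw [lt_div_iff₀ hΛ] at h2
  symm
  rw [Int.floor_eq_iff]
  constructor <;> linarith

/-- Distinct cells are disjoint (`Λ > 0`). [folklore] -/
theorem pairwise_disjoint_cell {Λ : ℝ} (hΛ : 0 < Λ) : Pairwise (Function.onFun Disjoint (cell (d := d) Λ)) := by
  intro x x' hne
  refine Set.disjoint_left.2 fun y hy hy' => hne ?_
  rw [eq_floor_of_mem_cell hΛ hy, eq_floor_of_mem_cell hΛ hy']

/-- The cells cover `ℝ^d` (`Λ > 0`). [folklore] -/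
theorem iUnion_cell {Λ : ℝ} (hΛ : 0 < Λ) : (⋃ x : Site d, cell Λ x) = Set.univ :=
  Set.eq_univ_of_forall fun y => Set.mem_iUnion.2 ⟨_, mem_cell_floor hΛ y⟩

/-- `vol(Q_x) = Λ^{-d}` (`Λ > 0`), in `ℝ≥0∞`. [folklore] -/
theorem volume_cell {Λ : ℝ} (hΛ : 0 < Λ) (x : Site d) : volume (cell Λ x) = ENNReal.ofReal ((Λ ^ d)⁻¹) := by
  rw [cell, volume_pi_pi]
  simp only [Real.volume_Ico]
  have e : ∀ i : Fin d, ((x i : ℝ) + 1) / Λ - (x i : ℝ) / Λ = Λ⁻¹ := fun i => by field_simp; ring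
  simp_rw [e]
  rw [Finset.prod_const, Finset.card_univ, Fintype.card_fin, ← ENNReal.ofReal_pow (by positivity), inv_pow]

/-- `vol(Q_x) = Λ^{-d}` (`Λ > 0`). [folklore] -/
theorem volume_real_cell {Λ : ℝ} (hΛ : 0 < Λ) (x : Site d) : volume.real (cell Λ x) = (Λ ^ d)⁻¹ := by
  rw [Measure.real, volume_cell hΛ, ENNReal.toReal_ofReal (by positivity)]

/-- Points of a cell are within `Λ⁻¹` of its corner: `‖y - x/Λ‖_∞ ≤ Λ⁻¹`. [folklore] -/
theorem norm_sub_corner_le {Λ : ℝ} (hΛ : 0 < Λ) {x : Site d} {y : Fin d → ℝ} (hy : y ∈ cell Λ x) :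
    ‖y - fun i => (x i : ℝ) / Λ‖ ≤ Λ⁻¹ := by
  rw [mem_cell_iff] at hy
  refine (pi_norm_le_iff_of_nonneg (by positivity)).2 fun i => ?_
  obtain ⟨h1, h2⟩ := hy i
  simp only [Pi.sub_apply, Real.norm_eq_abs]
  rw [abs_le]
  have e : ((x i : ℝ) + 1) / Λ = (x i : ℝ) / Λ + Λ⁻¹ := by field_simp
  constructor <;> linarith [inv_pos.2 hΛ]

/-! ### The Riemann-sum estimate -/

/-- Card of the coordinate box: `#box(R) ≤ (2R+1)^d` (`R ≥ 0`). [folklore] -/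
theorem card_box_le {R : ℝ} (hR : 0 ≤ R) : ((PT.box (d := d) R).card : ℝ) ≤ (2 * R + 1) ^ d := by
  have hcnt : ((Finset.Icc ⌈-R⌉ ⌊R⌋).card : ℝ) ≤ 2 * R + 1 := by
    rw [Int.card_Icc]
    have h1 : ((⌊R⌋ : ℤ) : ℝ) ≤ R := Int.floor_le R
    have h2 : (-R : ℝ) ≤ ⌈-R⌉ := Int.le_ceil (-R)
    rcases le_or_gt 0 (⌊R⌋ + 1 - ⌈-R⌉) with h | h
    · have e : (((⌊R⌋ + 1 - ⌈-R⌉).toNat : ℕ) : ℤ) = ⌊R⌋ + 1 - ⌈-R⌉ := Int.toNat_of_nonneg h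
      have e' : (((⌊R⌋ + 1 - ⌈-R⌉).toNat : ℕ) : ℝ) = ((⌊R⌋ : ℤ) : ℝ) + 1 - ⌈-R⌉ := by
        have := congrArg (fun z : ℤ => (z : ℝ)) e
        push_cast at this
        exact this
      rw [e']
      linarith
    · rw [Int.toNat_eq_zero.mpr h.le]
      push_cast
      linarith
  have hcard : (((PT.box (d := d) R).card : ℕ) : ℝ) = ((Finset.Icc ⌈-R⌉ ⌊R⌋).card : ℝ) ^ d := by
    rw [PT.box, Fintype.card_piFinset, Finset.prod_const, Finset.card_univ, Fintype.card_fin]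
    push_cast
    rfl
  rw [hcard]
  exact pow_le_pow_left₀ (Nat.cast_nonneg _) hcnt d

/-- Off the box `box(Λρ+1)` some coordinate exceeds `Λρ+1` in absolute value. [folklore] -/
theorem exists_abs_gt_of_not_mem_box {R : ℝ} {x : Site d} (hx : x ∉ PT.box R) :
    ∃ i, R < |(x i : ℝ)| := by
  rw [PT.box, Fintype.mem_piFinset] at hx
  push Not at hx
  obtain ⟨i, hi⟩ := hx
  refine ⟨i, ?_⟩
  rw [Finset.mem_Icc, not_and_or, not_le, not_le] at hi
  rcases hi with h | h
  · have h' : x i + 1 ≤ ⌈-R⌉ := h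
    have h1 : ((x i : ℤ) : ℝ) + 1 ≤ ⌈-R⌉ := by exact_mod_cast h'
    have h2 := Int.ceil_lt_add_one (-R)
    rw [lt_abs]; right; linarith
  · have h' : ⌊R⌋ + 1 ≤ x i := h
    have h1 : ((⌊R⌋ : ℤ) : ℝ) + 1 ≤ (x i : ℝ) := by exact_mod_cast h'
    have h2 := Int.lt_floor_add_one R
    rw [lt_abs]; left; linarith

/-- **Riemann sums of a Lipschitz, compactly supported function over `Λ⁻¹ℤ^d`**: if
`|F(y) - F(y')| ≤ K‖y - y'‖_∞` and `F(y) = 0` for `‖y‖_∞ > ρ`, then for `Λ ≥ 1`,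
`|Λ^{-d}Σ_{x∈ℤ^d}F(x/Λ) - ∫_{ℝ^d}F| ≤ K(2ρ+3)^dΛ⁻¹` (the sum being over the box `|x_i| ≤ Λρ+1`,
outside which `F(x/Λ) = 0`) — "Riemann sum approximation gives `L^{-dk}Σ_{y∈L^{-k}ℤ^d}c₀(y)c_l(y) -
∫c₀(y)c_l(y)dy = O(L^{-k})‖∇(c₀c_l)‖_{L^∞}`". [cite: Slade2017, Lemma 5.2.2 (proof, §10.4: "Riemann sum approximation")] -/
theorem abs_riemannSum_sub_integral_le {F : (Fin d → ℝ) → ℝ} {K ρ : ℝ} (hK : 0 ≤ K)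
    (hρ : 0 ≤ ρ) (hlip : ∀ y y', |F y - F y'| ≤ K * ‖y - y'‖) (hsupp : ∀ y, ρ < ‖y‖ → F y = 0)
    {Λ : ℝ} (hΛ : 1 ≤ Λ) :
    Integrable F ∧
    |(Λ ^ d)⁻¹ * ∑ x ∈ PT.box (Λ * ρ + 1), F (fun i => (x i : ℝ) / Λ) - ∫ y, F y| ≤
      K * (2 * ρ + 3) ^ d * Λ⁻¹ := by
  have hΛ0 : 0 < Λ := by linarith
  -- continuity and integrability
  have hcont : Continuous F := by
    have hl : LipschitzWith (Real.toNNReal K) F := LipschitzWith.of_dist_le_mul fun y y' => by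
      rw [Real.dist_eq, dist_eq_norm, Real.coe_toNNReal K hK]
      exact hlip y y'
    exact hl.continuous
  have hsuppF : Function.support F ⊆ Metric.closedBall (0 : Fin d → ℝ) ρ := by
    intro y hy
    rw [Metric.mem_closedBall, dist_zero_right]
    by_contra h
    exact hy (hsupp y (lt_of_not_ge h))
  have hFi : Integrable F :=
    (integrableOn_iff_integrable_of_support_subset hsuppF).1
      (hcont.continuousOn.integrableOn_compact (isCompact_closedBall 0 ρ))
  refine ⟨hFi, ?_⟩
  -- decomposition of the integral over the cells
  have hI : HasSum (fun x : Site d => ∫ y in cell Λ x, F y) (∫ y, F y) := by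
    have h := hasSum_integral_iUnion (measurableSet_cell Λ) (pairwise_disjoint_cell hΛ0) hFi.integrableOn
    rwa [iUnion_cell hΛ0, Measure.restrict_univ] at h
  set B : Finset (Site d) := PT.box (Λ * ρ + 1) with hB
  -- cells off the box do not meet the support, and the corner value vanishes there
  have hfar : ∀ x : Site d, x ∉ B → (∀ y ∈ cell Λ x, F y = 0) ∧ F (fun i => (x i : ℝ) / Λ) = 0 := by
    intro x hx
    obtain ⟨i, hi⟩ := exists_abs_gt_of_not_mem_box hx
    have hcorner : ρ < ‖fun i => (x i : ℝ) / Λ‖ := by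
      have h1 : ρ < |(x i : ℝ) / Λ| := by
        rw [abs_div, abs_of_pos hΛ0, lt_div_iff₀ hΛ0]; linarith
      have h3 := norm_le_pi_norm (fun i => (x i : ℝ) / Λ) i
      rw [Real.norm_eq_abs] at h3
      exact lt_of_lt_of_le h1 h3
    refine ⟨fun y hy => hsupp y ?_, hsupp _ hcorner⟩
    have h1 : ρ + Λ⁻¹ < |(x i : ℝ) / Λ| := by
      rw [abs_div, abs_of_pos hΛ0, lt_div_iff₀ hΛ0]
      have : (ρ + Λ⁻¹) * Λ = Λ * ρ + 1 := by field_simp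
      linarith
    have h2 := norm_sub_corner_le hΛ0 hy
    have h3 := norm_le_pi_norm (fun i => (x i : ℝ) / Λ) i
    rw [Real.norm_eq_abs] at h3
    have h4 := norm_sub_norm_le (fun i => (x i : ℝ) / Λ) y
    rw [← norm_neg, neg_sub] at h2
    linarith
  have hI' : ∫ y, F y = ∑ x ∈ B, ∫ y in cell Λ x, F y := by
    rw [← hI.tsum_eq, tsum_eq_sum fun x hx => ?_]
    exact setIntegral_eq_zero_of_forall_eq_zero (hfar x hx).1
  -- each cell contributes an error `≤ KΛ^{-1}Λ^{-d}`
  have hcellb : ∀ x : Site d, |(∫ y in cell Λ x, F y) - (Λ ^ d)⁻¹ * F (fun i => (x i : ℝ) / Λ)| ≤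
      K * Λ⁻¹ * (Λ ^ d)⁻¹ := by
    intro x
    have hvol := volume_real_cell hΛ0 x
    have hfin : volume (cell Λ x) < ⊤ := by
      rw [volume_cell hΛ0]
      exact ENNReal.ofReal_lt_top
    have hci : IntegrableOn (fun _ : Fin d → ℝ => F (fun i => (x i : ℝ) / Λ)) (cell Λ x) :=
      integrableOn_const hfin.ne
    have e1 : (Λ ^ d)⁻¹ * F (fun i => (x i : ℝ) / Λ) = ∫ _ in cell Λ x, F (fun i => (x i : ℝ) / Λ) := by
      rw [setIntegral_const, hvol, smul_eq_mul]
    rw [e1, ← integral_sub hFi.integrableOn hci]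
    have hle : ∀ y ∈ cell Λ x, ‖F y - F (fun i => (x i : ℝ) / Λ)‖ ≤ K * Λ⁻¹ := fun y hy => by
      rw [Real.norm_eq_abs]
      exact (hlip _ _).trans (mul_le_mul_of_nonneg_left (norm_sub_corner_le hΛ0 hy) hK)
    have hb := norm_setIntegral_le_of_norm_le_const hfin hle
    rw [Real.norm_eq_abs, hvol] at hb
    exact hb
  -- sum over the box
  have hcard : ((B.card : ℕ) : ℝ) ≤ ((2 * ρ + 3) * Λ) ^ d := by
    refine (card_box_le (by positivity)).trans ?_
    apply pow_le_pow_left₀ (by positivity)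
    nlinarith
  rw [hI', Finset.mul_sum, ← Finset.sum_sub_distrib]
  calc |∑ x ∈ B, ((Λ ^ d)⁻¹ * F (fun i => (x i : ℝ) / Λ) - ∫ y in cell Λ x, F y)|
      ≤ ∑ x ∈ B, |(Λ ^ d)⁻¹ * F (fun i => (x i : ℝ) / Λ) - ∫ y in cell Λ x, F y| := Finset.abs_sum_le_sum_abs _ _
    _ ≤ ∑ _x ∈ B, K * Λ⁻¹ * (Λ ^ d)⁻¹ := Finset.sum_le_sum fun x _ => by
        rw [abs_sub_comm]; exact hcellb x
    _ = B.card * (K * Λ⁻¹ * (Λ ^ d)⁻¹) := by rw [Finset.sum_const, nsmul_eq_mul]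
    _ ≤ ((2 * ρ + 3) * Λ) ^ d * (K * Λ⁻¹ * (Λ ^ d)⁻¹) := mul_le_mul_of_nonneg_right hcard (by positivity)
    _ = K * (2 * ρ + 3) ^ d * Λ⁻¹ := by
        rw [mul_pow]; field_simp

end FRD

end LongRangePhi4

end Literature.Barriers.CriticalPhenomena
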